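import Summits.BirchSwinnertonDyer.BirchSwinnertonDyer.Theorems.ManinLocalTwoThreeManinOddAtFourTwinNormalForm
import Summits.BirchSwinnertonDyer.BirchSwinnertonDyer.Theorems.ManinLocalTwoThreeLevelFreeTwistTransport
import HarnessLib

/-!
# Route `ManinLocalTwoThree` (cell `bsd-f2-manin`): crux C2 `ManinOddAtFour` (stmt-BirchSwinnertonDyer-22967)
# REDUCED to the (odd level, |Δ_min|, level, sign)-MINIMAL classes — aligned `χ±8` partners at ANY 2-level

The landed reductions of this seat (`…ManinOddAtFourTwistOrbitMinimal`, `…TwinNormalForm`, gen 2) orient every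
twist edge by (level, `|Δ_min|`): a class is discharged via a partner of LOWER level, or of the same level and
smaller `|Δ_min|`. A `±2`-twist between two classes additive at `2` moves `v₂(Δ_min)` by `±6` and the
`2`-level either way; when the level goes UP while `|Δ|` goes DOWN ("misaligned lift": 13 677 classes
`2⁵ → 2⁶` in the cell census, `c ∣ 2c'` only) neither orientation was available. With the LEVEL-FREE engine
`maninLocalTwoThree_maninConstant_dvd_of_additiveTwist_two_aligned_levelFree` (this seat, gen 3:
`Λ(f) = Λ(ι₁ f)` inside the radical, no Ihara input) the pair is read from its smaller-`|Δ|` end, where it IS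
aligned, and `c(2⁵-class) ∣ c(2⁶-class)` exactly. Main theorem
`maninLocalTwoThree_maninOddAtFour_of_discLevelMinimal`: the route decl BY NAME from Manin's conjecture at `2` on
the classes minimal for (odd part of `N`, `|Δ_min|`, `N`, `[c₆ < 0]`) among aligned partners — clauses (i)–(vi) of
the twin normal form with (iii)/(iv) re-cut: (iii) `χ₋₄`-untwist to a lattice-optimal additive `A` of lower
level with `|Δ_min(A)| ≤ |Δ_min(W)|`; (iv) aligned `χ±8`-untwist at ANY `2`-level `N(A) ∣ 2⁶N` with
`|Δ_min(A)| < |Δ_min(W)|` (or lower level and `≤`). Induction on (`ordCompl[2] N`, `|Δ_min|`, `2N + [c₆<0]`).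

CENSUS (cell table TWISTCENSUS2 joined on exact discriminants from the a-invariants; this seat's script
census7.py, 34 s; optimal classes with `4 ∣ N ≤ 5·10⁵`, all with `c = 1` by Cremona): residue **220 053** —
`v₂(N)` 2: 93 890 · 3: 95 159 · 4: 0 · 5: 17 925 · 6: 5 383 · 7: 5 280 · 8: 2 416; `W[2]` irreducible ∧ Δ<0:
117 714 · irreducible ∧ Δ>0 (Ra): 47 992 · reducible (Rb): 54 347 — against 224 232 for the landed twin normal
form. The two residues are DIFFERENT normal forms (intersection 218 870, union 225 415): 5 362 classes with
`v₂(N) = 5` leave (eliminated by their aligned `2⁶`-partner of smaller `|Δ|`), 1 183 with `v₂(N) = 6` enter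
(they were eliminated only by a lower-level aligned partner of LARGER `|Δ|`, an orientation the new measure
forbids; 8 368 `2⁵ ⇄ 2⁶` pairs are aligned BOTH ways — exact two-cycles `c = ±c'` — so no single measure admits
both edge types). OPEN on the residue; nothing here proves BSD or Manin's conjecture. Seat bsd-line-manin23-p2
(gen 3).

References: [Stevens1989] Lemmas (5.2), (5.4); [Cesnavicius2018] Thm. 1.2; [Pal2012] Prop. 2.4, Lemma 3.1;
[Manin1972] Prop. 1.4.
-/

set_option autoImplicit false
set_option linter.dupNamespace false

noncomputable section

open scoped MatrixGroups ModularForm Classical NumberField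

namespace Summit.BirchSwinnertonDyer.BirchSwinnertonDyer.Theorems

open CongruenceSubgroup WeierstrassCurve IsDedekindDomain IsDedekindDomain.HeightOneSpectrum
  Rat.HeightOneSpectrum Literature.NumberTheory.Automorphic
  Literature.NumberTheory.EllipticCurves Literature.NumberTheory.EllipticCurves.ModularForms
  Summit.BirchSwinnertonDyer.Rank1Residual.ManinAdditive

/-! ## §1 The odd part of the level along the untwists -/

/-- **An odd semistable untwist strictly lowers the odd part of the level**: if `N₁ ∣ N`, `q` is an odd
prime with `q² ∣ N` and `q² ∤ N₁`, then `ordCompl[2] N₁ < ordCompl[2] N`. [elementary] -/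
theorem maninLocalTwoThree_ordCompl_two_lt_of_dvd {N₁ N q : ℕ} (hN : N ≠ 0) (hq : q.Prime) (hq2 : q ≠ 2)
    (hN₁N : N₁ ∣ N) (hqN : q ^ 2 ∣ N) (hqN₁ : ¬ q ^ 2 ∣ N₁) :
    ordCompl[2] N₁ < ordCompl[2] N := by
  have hdvd : ordCompl[2] N₁ ∣ ordCompl[2] N := Nat.ordCompl_dvd_ordCompl_of_dvd hN₁N 2
  have h2q : ¬ 2 ∣ q ^ 2 := by
    intro h
    have := (Nat.prime_dvd_prime_iff_eq Nat.prime_two hq).mp (Nat.prime_two.dvd_of_dvd_pow h)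
    exact hq2 this.symm
  have hq' : q ^ 2 ∣ ordCompl[2] N := Nat.dvd_ordCompl_of_dvd_not_dvd hqN h2q
  have hpos : 0 < ordCompl[2] N := Nat.ordCompl_pos 2 hN
  refine lt_of_le_of_ne (Nat.le_of_dvd hpos hdvd) fun h ↦ hqN₁ ?_
  exact (h ▸ hq').trans (Nat.ordCompl_dvd N₁ 2)

/-- **A dyadic untwist does not raise the odd part of the level**: `N' ∣ 2⁶·N ⟹ ordCompl[2] N' ≤ ordCompl[2] N`.
[elementary] -/
theorem maninLocalTwoThree_ordCompl_two_le_of_dvd_pow_mul {N' N : ℕ} (hN : N ≠ 0) (h : N' ∣ 2 ^ 6 * N) :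
    ordCompl[2] N' ≤ ordCompl[2] N := by
  have hdvd : ordCompl[2] N' ∣ ordCompl[2] (2 ^ 6 * N) := Nat.ordCompl_dvd_ordCompl_of_dvd h 2
  rw [Nat.ordCompl_self_pow_mul N 6 Nat.prime_two] at hdvd
  exact Nat.le_of_dvd (Nat.ordCompl_pos 2 hN) hdvd

/-! ## §2 C2 ⟸ Manin at `2` on the (odd level, |Δ_min|, 2-level, sign)-minimal classes -/

/-- **Crux C2 `ManinOddAtFour` ⟸ Manin's conjecture at `2` on the optimal classes that are MINIMAL for
(odd part of the conductor, `|Δ_min|`, conductor, `[c₆ < 0]`) among their aligned twist partners** (one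
hypothesis, kernel-checked composition). Modulo the four printed facts it suffices to prove `2 ∤ c` for the
lattice-optimal data `D` with `4 ∣ N` whose class admits (i) no dyadic untwist to a class semistable at `2`;
(ii) no odd semistable untwist `χ_{q*}`; (iii) no `χ₋₄`-untwist to a lattice-optimal ADDITIVE `A` of LOWER
conductor `N(A) ∣ N` with `|Δ_min(A)| ≤ |Δ_min(W)|` (`2⁴ ∣ N`); (iv) no ALIGNED `χ±8`-untwist to a lattice-optimal
additive `A` at ANY `2`-level `N(A) ∣ 2⁶N` — minimal model `C ∼ W` of `A ⊗ ℚ(√±2)` with `Δ(C) = d⁶Δ(A)` — with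
`|Δ_min(A)| < |Δ_min(W)|`, or with `N(A) < N` and `|Δ_min(A)| ≤ |Δ_min(W)|` (NEW REACH over the landed
twist-orbit-minimal reduction: the partner may have HIGHER `2`-level — the lower ends of the misaligned
`2⁵ → 2⁶` lifts are aligned `2⁶ → 2⁵` edges; level-free engine
`maninLocalTwoThree_maninConstant_dvd_of_additiveTwist_two_aligned_levelFree`); (v) no aligned same-level
`χ_{q*}`-untwist with smaller `|Δ_min|`; (vi) the twin normal form (`c₆ ≥ 0` on `χ₋₄`-twin pairs). Induction
on (`ordCompl[2] N`, `|Δ_min|`, `2N + [c₆ < 0]`): (ii) lowers the odd part of the level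
(`maninLocalTwoThree_ordCompl_two_lt_of_dvd`), every dyadic clause keeps it and lowers (`|Δ_min|`, level,
sign) lexicographically. CENSUS (cell table TWISTCENSUS2, this seat's join census7.py; optimal classes with
`4 ∣ N ≤ 5·10⁵`): residue **220 053** (`v₂(N)`: 2: 93 890 · 3: 95 159 · 5: 17 925 · 6: 5 383 · 7: 5 280 · 8:
2 416; irr ∧ Δ<0: 117 714 · Ra 47 992 · Rb 54 347) against 224 232 for the landed twin normal form
(intersection 218 870: on an exact `2⁵ ⇄ 2⁶` two-cycle `c = ±c'` and the two normal forms keep opposite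
ends). OPEN on that residue; nothing here proves BSD or Manin's conjecture.
[cite: Stevens1989, Lemmas (5.2), (5.4)] [cite: Cesnavicius2018, Thm. 1.2] [cite: Pal2012, Prop. 2.4, Lemma 3.1] -/
theorem maninLocalTwoThree_maninOddAtFour_of_discLevelMinimal
    (H : Literature.NumberTheory.EllipticCurves.ModularForms.mazur_not_dvd_maninConstant_of_odd →
      Literature.NumberTheory.EllipticCurves.ModularForms.abbesUllmo_not_dvd_maninConstant_of_not_dvd_level →
      Literature.NumberTheory.EllipticCurves.ModularForms.cesnavicius_not_two_dvd_maninConstant_of_two_dvd_level →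
      Literature.NumberTheory.EllipticCurves.ModularForms.exists_isNewformOf →
      ∀ (W : WeierstrassCurve ℚ) [W.IsElliptic] [W.IsGloballyMinimal] {N : ℕ} [NeZero N]
        (D : ModularParametrizationData W N),
        (∀ z ∈ D.L.lattice, ∃ w ∈ periodLattice D.f, z = D.c * w) → 2 ^ 2 ∣ N →
        ¬ (∃ (W' : WeierstrassCurve ℚ) (d : ℤ), W'.IsElliptic ∧ W'.IsGloballyMinimal ∧
          (d = -1 ∨ d = 2 ∨ d = -2) ∧ IsIsogenous W (W'.quadraticTwist (d : ℚ)) ∧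
          ¬ 2 ^ 2 ∣ W'.conductorNorm ℤ) →
        ¬ (∃ (W' : WeierstrassCurve ℚ) (q : ℕ), W'.IsElliptic ∧ W'.IsGloballyMinimal ∧
          q.Prime ∧ q ≠ 2 ∧ q ^ 2 ∣ N ∧
          IsIsogenous W (W'.quadraticTwist (((-1 : ℤ) ^ (q / 2) * q : ℤ) : ℚ)) ∧
          ¬ q ^ 2 ∣ W'.conductorNorm ℤ) →
        ¬ (∃ (A : WeierstrassCurve ℚ) (_ : A.IsElliptic) (_ : A.IsGloballyMinimal) (N' : ℕ) (_ : NeZero N')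
          (D' : ModularParametrizationData A N'),
          (∀ z ∈ D'.L.lattice, ∃ w ∈ periodLattice D'.f, z = D'.c * w) ∧ 2 ^ 4 ∣ N ∧
          2 ^ 2 ∣ A.conductorNorm ℤ ∧ A.conductorNorm ℤ ∣ N ∧ A.conductorNorm ℤ < N ∧
          IsIsogenous W (A.quadraticTwist ((-1 : ℤ) : ℚ)) ∧
          A.minimalDiscriminantInt.natAbs ≤ W.minimalDiscriminantInt.natAbs) →
        ¬ (∃ (A : WeierstrassCurve ℚ) (_ : A.IsElliptic) (_ : A.IsGloballyMinimal) (N' : ℕ) (_ : NeZero N')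
          (D' : ModularParametrizationData A N') (d : ℤ) (C : WeierstrassCurve ℚ) (u : VariableChange ℚ),
          C.IsElliptic ∧ C.IsGloballyMinimal ∧
          (∀ z ∈ D'.L.lattice, ∃ w ∈ periodLattice D'.f, z = D'.c * w) ∧ (d = 2 ∨ d = -2) ∧
          2 ^ 2 ∣ A.conductorNorm ℤ ∧ A.conductorNorm ℤ ∣ 2 ^ 6 * N ∧
          IsIsogenous W (A.quadraticTwist (d : ℚ)) ∧ u • A.quadraticTwist (d : ℚ) = C ∧
          C.Δ = (d : ℚ) ^ 6 * A.Δ ∧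
          (A.minimalDiscriminantInt.natAbs < W.minimalDiscriminantInt.natAbs ∨
            (A.conductorNorm ℤ < N ∧ A.minimalDiscriminantInt.natAbs ≤ W.minimalDiscriminantInt.natAbs))) →
        ¬ (∃ (A : WeierstrassCurve ℚ) (_ : A.IsElliptic) (_ : A.IsGloballyMinimal)
          (D' : ModularParametrizationData A N) (q : ℕ) (C : WeierstrassCurve ℚ) (u : VariableChange ℚ),
          C.IsElliptic ∧ C.IsGloballyMinimal ∧
          (∀ z ∈ D'.L.lattice, ∃ w ∈ periodLattice D'.f, z = D'.c * w) ∧ q.Prime ∧ q ≠ 2 ∧ q ^ 2 ∣ N ∧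
          IsIsogenous C W ∧ u • A.quadraticTwist (((-1 : ℤ) ^ (q / 2) * q : ℤ) : ℚ) = C ∧
          C.Δ = ((((-1 : ℤ) ^ (q / 2) * q : ℤ)) : ℚ) ^ 6 * A.Δ ∧
          A.minimalDiscriminantInt.natAbs < W.minimalDiscriminantInt.natAbs) →
        ¬ (W.c₆ < 0 ∧ ∃ (A : WeierstrassCurve ℚ) (_ : A.IsElliptic) (_ : A.IsGloballyMinimal)
          (D' : ModularParametrizationData A N),
          (∀ z ∈ D'.L.lattice, ∃ w ∈ periodLattice D'.f, z = D'.c * w) ∧ 2 ^ 4 ∣ N ∧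
          2 ^ 2 ∣ A.conductorNorm ℤ ∧ IsIsogenous W (A.quadraticTwist ((-1 : ℤ) : ℚ)) ∧
          A.minimalDiscriminantInt.natAbs ≤ W.minimalDiscriminantInt.natAbs ∧ 0 < A.c₆) →
        ¬ (2 : ℤ) ∣ D.maninConstant) :
    Summit.BirchSwinnertonDyer.BirchSwinnertonDyer.Theses.ManinLocalTwoThree.ManinOddAtFour := by
  intro hM hAU hC2 hnf
  -- measure: (`ordCompl[2] N`, `|Δ_min W|`, `2N + [c₆(W) < 0]`), lexicographic
  suffices key : ∀ (o m n : ℕ) (W : WeierstrassCurve ℚ) [W.IsElliptic] [W.IsGloballyMinimal] (N : ℕ)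
      [NeZero N] (D : ModularParametrizationData W N), ordCompl[2] N < o →
      W.minimalDiscriminantInt.natAbs < m → 2 * N + (if W.c₆ < 0 then 1 else 0) < n →
      (∀ z ∈ D.L.lattice, ∃ w ∈ periodLattice D.f, z = D.c * w) → 2 ^ 2 ∣ N →
      ¬ (2 : ℤ) ∣ D.maninConstant by
    intro W _ _ N _ D hopt h4
    exact key (ordCompl[2] N + 1) (W.minimalDiscriminantInt.natAbs + 1)
      (2 * N + (if W.c₆ < 0 then 1 else 0) + 1) W N D (Nat.lt_succ_self _) (Nat.lt_succ_self _)
      (Nat.lt_succ_self _) hopt h4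
  have hb : ∀ X : WeierstrassCurve ℚ, (if X.c₆ < 0 then 1 else 0) ≤ 1 := fun X ↦ by
    split_ifs <;> omega
  intro o
  induction o with
  | zero => intro m n W _ _ N _ D hO; exact absurd hO (Nat.not_lt_zero _)
  | succ o ihO =>
  intro m
  induction m with
  | zero => intro n W _ _ N _ D _ hm; exact absurd hm (Nat.not_lt_zero _)
  | succ m ihM =>
  intro n
  induction n with
  | zero => intro W _ _ N _ D _ _ hn; exact absurd hn (Nat.not_lt_zero _)
  | succ n ihN =>
    intro W _ _ N _ D hO hmm hnn hopt h4
    have hN : N = W.conductorNorm ℤ :=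
      IsNewformOf.level_eq_conductorNorm_of_exists_isNewformOf hnf D.isNewformOf
    have hN0 : N ≠ 0 := NeZero.ne N
    have hbW := hb W
    -- the lexicographic dispatcher onto the three induction hypotheses
    have IH : ∀ (W' : WeierstrassCurve ℚ) [W'.IsElliptic] [W'.IsGloballyMinimal] (N' : ℕ) [NeZero N']
        (D' : ModularParametrizationData W' N'),
        (ordCompl[2] N' < ordCompl[2] N ∨ (ordCompl[2] N' ≤ ordCompl[2] N ∧
          (W'.minimalDiscriminantInt.natAbs < W.minimalDiscriminantInt.natAbs ∨
            (W'.minimalDiscriminantInt.natAbs ≤ W.minimalDiscriminantInt.natAbs ∧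
              2 * N' + (if W'.c₆ < 0 then 1 else 0) < 2 * N + (if W.c₆ < 0 then 1 else 0))))) →
        (∀ z ∈ D'.L.lattice, ∃ w ∈ periodLattice D'.f, z = D'.c * w) → 2 ^ 2 ∣ N' →
        ¬ (2 : ℤ) ∣ D'.maninConstant := by
      intro W' _ _ N' _ D' hlex hopt' h4'
      rcases hlex with hlt | ⟨hle, hlt | ⟨hle', hlt'⟩⟩
      · exact ihO _ _ W' N' D' (by omega) (Nat.lt_succ_self _) (Nat.lt_succ_self _) hopt' h4'
      · exact ihM _ W' N' D' (by omega) (by omega) (Nat.lt_succ_self _) hopt' h4'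
      · exact ihN W' N' D' (by omega) (by omega) (by omega) hopt' h4'
    -- (i) a dyadic untwist to a class semistable at `2`: closed (twist-covered half)
    by_cases h1 : ∃ (W' : WeierstrassCurve ℚ) (d : ℤ), W'.IsElliptic ∧ W'.IsGloballyMinimal ∧
        (d = -1 ∨ d = 2 ∨ d = -2) ∧ IsIsogenous W (W'.quadraticTwist (d : ℚ)) ∧
        ¬ 2 ^ 2 ∣ W'.conductorNorm ℤ
    · exact maninLocalTwoThree_maninOddAtFour_twistCovered hM hAU hC2 hnf W D hopt h4 h1
    -- (ii) an odd semistable untwist: transport + the odd part of the level drops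
    by_cases h2 : ∃ (W' : WeierstrassCurve ℚ) (q : ℕ), W'.IsElliptic ∧ W'.IsGloballyMinimal ∧
        q.Prime ∧ q ≠ 2 ∧ q ^ 2 ∣ N ∧
        IsIsogenous W (W'.quadraticTwist (((-1 : ℤ) ^ (q / 2) * q : ℤ) : ℚ)) ∧
        ¬ q ^ 2 ∣ W'.conductorNorm ℤ
    · obtain ⟨W', q, hE', hM', hqp, hq2, hqN, htw, hqN'⟩ := h2
      haveI := hE'
      haveI := hM'
      haveI : Fact q.Prime := ⟨hqp⟩
      refine maninLocalTwoThree_not_dvd_maninConstant_of_oddUntwist hnf hq2 D hopt hqN htw hqN' ?_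
      intro W₁ _ _ N₁ _ D₁ hiso₁ hopt₁
      have hN₁ : N₁ = W'.conductorNorm ℤ := level_eq_conductorNorm_of_isIsogenous hnf D₁ hiso₁
      have hqNW : q ^ 2 ∣ W.conductorNorm ℤ := hN ▸ hqN
      have hadd : ¬ W.HasGoodReductionAtPrime q ∧ ¬ W.HasMultiplicativeReductionAtPrime q :=
        not_good_and_not_mult_of_sq_dvd_conductorNorm W hqNW
      have hN'N : W'.conductorNorm ℤ ∣ W.conductorNorm ℤ :=
        maninLocalTwoThree_conductorNorm_dvd_of_isIsogenous_twist_pStar hnf hq2 htw hqN' hadd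
      have hlt : ordCompl[2] N₁ < ordCompl[2] N := by
        rw [hN₁, hN]
        exact maninLocalTwoThree_ordCompl_two_lt_of_dvd (hN ▸ hN0) hqp hq2 hN'N hqNW hqN'
      have h4₁ : 2 ^ 2 ∣ N₁ := by
        rw [hN₁]
        exact maninLocalTwoThree_four_dvd_conductorNorm_of_isIsogenous_twist_pStar hnf hq2 htw (hN ▸ h4)
      exact IH W₁ N₁ D₁ (Or.inl hlt) hopt₁ h4₁
    -- (iii) a `χ₋₄`-untwist to a lattice-optimal additive curve of lower conductor with `|Δ_min| ≤`
    by_cases h3 : ∃ (A : WeierstrassCurve ℚ) (_ : A.IsElliptic) (_ : A.IsGloballyMinimal) (N' : ℕ)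
        (_ : NeZero N') (D' : ModularParametrizationData A N'),
        (∀ z ∈ D'.L.lattice, ∃ w ∈ periodLattice D'.f, z = D'.c * w) ∧ 2 ^ 4 ∣ N ∧
        2 ^ 2 ∣ A.conductorNorm ℤ ∧ A.conductorNorm ℤ ∣ N ∧ A.conductorNorm ℤ < N ∧
        IsIsogenous W (A.quadraticTwist ((-1 : ℤ) : ℚ)) ∧
        A.minimalDiscriminantInt.natAbs ≤ W.minimalDiscriminantInt.natAbs
    · obtain ⟨A, hAe, hAm, N', hN'0, D', hopt', h16, h4A, hAN, hlt, htw, hΔle⟩ := h3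
      have hN' : N' = A.conductorNorm ℤ :=
        IsNewformOf.level_eq_conductorNorm_of_exists_isNewformOf hnf D'.isNewformOf
      have hdvd : D.c ∣ D'.c :=
        maninLocalTwoThree_maninConstant_dvd_of_additiveTwist_negOne hnf D hopt h16 D' htw h4A hAN
      have hbA := hb A
      have hle : ordCompl[2] N' ≤ ordCompl[2] N :=
        Nat.le_of_dvd (Nat.ordCompl_pos 2 hN0) (Nat.ordCompl_dvd_ordCompl_of_dvd (hN' ▸ hAN) 2)
      have hD' : ¬ (2 : ℤ) ∣ D'.maninConstant :=
        IH A N' D' (Or.inr ⟨hle, Or.inr ⟨hΔle, by omega⟩⟩) hopt' (hN' ▸ h4A)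
      exact fun h ↦ hD' (h.trans hdvd)
    -- (iv) an aligned `χ±8`-untwist at ANY 2-level with smaller `|Δ_min|` (or lower level and `≤`)
    by_cases h5 : ∃ (A : WeierstrassCurve ℚ) (_ : A.IsElliptic) (_ : A.IsGloballyMinimal) (N' : ℕ)
        (_ : NeZero N') (D' : ModularParametrizationData A N') (d : ℤ) (C : WeierstrassCurve ℚ)
        (u : VariableChange ℚ),
        C.IsElliptic ∧ C.IsGloballyMinimal ∧
        (∀ z ∈ D'.L.lattice, ∃ w ∈ periodLattice D'.f, z = D'.c * w) ∧ (d = 2 ∨ d = -2) ∧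
        2 ^ 2 ∣ A.conductorNorm ℤ ∧ A.conductorNorm ℤ ∣ 2 ^ 6 * N ∧
        IsIsogenous W (A.quadraticTwist (d : ℚ)) ∧ u • A.quadraticTwist (d : ℚ) = C ∧
        C.Δ = (d : ℚ) ^ 6 * A.Δ ∧
        (A.minimalDiscriminantInt.natAbs < W.minimalDiscriminantInt.natAbs ∨
          (A.conductorNorm ℤ < N ∧ A.minimalDiscriminantInt.natAbs ≤ W.minimalDiscriminantInt.natAbs))
    · obtain ⟨A, hAe, hAm, N', hN'0, D', d, C, u, hCe, hCm, hopt', hd, h4A, hAN, htw, hu, hΔ, hlow⟩ := h5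
      haveI := hCe
      haveI := hCm
      have hN' : N' = A.conductorNorm ℤ :=
        IsNewformOf.level_eq_conductorNorm_of_exists_isNewformOf hnf D'.isNewformOf
      refine maninLocalTwoThree_not_dvd_maninConstant_of_additiveUntwist_two_aligned_levelFree hnf D hopt h4
        hd D' htw h4A hAN u hu hΔ ?_
      have h4N' : 2 ^ 2 ∣ N' := hN' ▸ h4A
      have hbA := hb A
      have hle : ordCompl[2] N' ≤ ordCompl[2] N :=
        maninLocalTwoThree_ordCompl_two_le_of_dvd_pow_mul hN0 (hN' ▸ hAN)
      rcases hlow with hmA | ⟨hlt, hmA⟩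
      · exact IH A N' D' (Or.inr ⟨hle, Or.inl hmA⟩) hopt' h4N'
      · have hlt' : N' < N := hN' ▸ hlt
        exact IH A N' D' (Or.inr ⟨hle, Or.inr ⟨hmA, by omega⟩⟩) hopt' h4N'
    -- (v) an aligned same-level `χ_{q*}`-untwist with smaller `|Δ_min|`
    by_cases h6 : ∃ (A : WeierstrassCurve ℚ) (_ : A.IsElliptic) (_ : A.IsGloballyMinimal)
        (D' : ModularParametrizationData A N) (q : ℕ) (C : WeierstrassCurve ℚ) (u : VariableChange ℚ),
        C.IsElliptic ∧ C.IsGloballyMinimal ∧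
        (∀ z ∈ D'.L.lattice, ∃ w ∈ periodLattice D'.f, z = D'.c * w) ∧ q.Prime ∧ q ≠ 2 ∧ q ^ 2 ∣ N ∧
        IsIsogenous C W ∧ u • A.quadraticTwist (((-1 : ℤ) ^ (q / 2) * q : ℤ) : ℚ) = C ∧
        C.Δ = ((((-1 : ℤ) ^ (q / 2) * q : ℤ)) : ℚ) ^ 6 * A.Δ ∧
        A.minimalDiscriminantInt.natAbs < W.minimalDiscriminantInt.natAbs
    · obtain ⟨A, hAe, hAm, D', q, C, u, hCe, hCm, hopt', hqp, hq2, hqN, hCW, hu, hΔ, hmA⟩ := h6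
      haveI := hCe
      haveI := hCm
      haveI : Fact q.Prime := ⟨hqp⟩
      have hadd : ¬ W.HasGoodReductionAtPrime q ∧ ¬ W.HasMultiplicativeReductionAtPrime q :=
        not_good_and_not_mult_of_sq_dvd_conductorNorm W (hN ▸ hqN)
      refine maninLocalTwoThree_not_dvd_maninConstant_of_untwist_pStar_aligned hq2 D hopt D' dvd_rfl hqN
        hadd u hu hCW hΔ ?_
      exact IH A N D' (Or.inr ⟨le_rfl, Or.inl hmA⟩) hopt' h4
    -- (vi) the twin normal form: `c₆(W) < 0` and a lattice-optimal same-level `χ₋₄`-twin with `c₆ > 0`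
    by_cases h7 : W.c₆ < 0 ∧ ∃ (A : WeierstrassCurve ℚ) (_ : A.IsElliptic) (_ : A.IsGloballyMinimal)
        (D' : ModularParametrizationData A N),
        (∀ z ∈ D'.L.lattice, ∃ w ∈ periodLattice D'.f, z = D'.c * w) ∧ 2 ^ 4 ∣ N ∧
        2 ^ 2 ∣ A.conductorNorm ℤ ∧ IsIsogenous W (A.quadraticTwist ((-1 : ℤ) : ℚ)) ∧
        A.minimalDiscriminantInt.natAbs ≤ W.minimalDiscriminantInt.natAbs ∧ 0 < A.c₆
    · obtain ⟨hW6, A, hAe, hAm, D', hopt', h16, h4A, htw, hle, hA6⟩ := h7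
      have hN' : N = A.conductorNorm ℤ :=
        IsNewformOf.level_eq_conductorNorm_of_exists_isNewformOf hnf D'.isNewformOf
      have hdvd : D.c ∣ D'.c :=
        maninLocalTwoThree_maninConstant_dvd_of_additiveTwist_negOne hnf D hopt h16 D' htw h4A (hN' ▸ dvd_rfl)
      have hbA0 : (if A.c₆ < 0 then 1 else 0) = 0 := if_neg (not_lt.mpr hA6.le)
      have hbW1 : (if W.c₆ < 0 then 1 else 0) = 1 := if_pos hW6
      have hD' : ¬ (2 : ℤ) ∣ D'.c :=
        IH A N D' (Or.inr ⟨le_rfl, Or.inr ⟨hle, by omega⟩⟩) hopt' h4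
      exact fun h ↦ hD' (h.trans hdvd)
    · exact H hM hAU hC2 hnf W D hopt h4 h1 h2 h3 h5 h6 h7

end Summit.BirchSwinnertonDyer.BirchSwinnertonDyer.Theorems

end
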